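import Summits.CriticalPhenomena.SAWScalingLimit.Theorems.SAWDefectDecoherenceMassRatioRenewalDefs
import Summits.CriticalPhenomena.SAWScalingLimit.Theorems.MassRatio.Negative.Component

/-!
# Crux `SAWDefectDecoherence.MassRatio` (stmt-CriticalPhenomena-8550), line `renewal-averaging-at-b` — toolkit of stub `stub_lateralConfinement`

Part file WITHOUT the (open) stub `stub_lateralConfinement`
(`∀ ε ∃ A ≥ 1 ∃ t₂ ∀ t ≥ t₂ ∀ W m p, boxMass m p t W ≤ boxMass m p t (A t) + ε`); vocabulary of
`Theorems/SAWDefectDecoherenceMassRatioRenewalDefs.lean`. Sub-namespace `LateralConfinement`: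

* `kernel_mono_W`, `boxMass_mono_W`, `boxMass_le_boxMass_mul` — the MONOTONE HALF of the stub
  (`W ≤ A t → boxMass m p t W ≤ boxMass m p t (A t)`; `NoSplit` depends on the vertex list only).
* `Wide`, `wideKernel`, `wideMass m p t W V` — the part of `boxMass m p t W` carried by renewal-free
  prefixes LEAVING the window `|pos - p| ≤ V`; `restrict`; the decomposition
  `boxMass_le_add_wideMass : boxMass m p t W ≤ boxMass m p t V + wideMass m p t W V` (all `W, V`) and
  its converse bookkeeping `wideMass_le_sub` (`V ≤ W`), `wideMass_eq_zero` (`W ≤ V`).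
* `LateralTightness w` and `stub_lateralConfinement_of_lateralTightness`, `lateralTightness_of_stub`:
  **the stub is EQUIVALENT to `LateralTightness wideMass`** — uniform-in-`t` tightness of the
  width/height ratio of renewal-free critical half-plane SAW prefixes; predicted by isotropic scaling,
  OPEN. What the known sum rules give and why it is not enough (DCS12 = Duminil-Copin–Smirnov 2012 §3;
  GM20 = Glazman–Manolescu 2020 Prop. 1.1; KP23 = Krachun–Panagiotis arXiv:2310.17299):
  (1) EXIT masses are uniformly small — for the truncated triangle `Ω(T,M) = S_T ∩ T_M`,
  `1 = c_α A^Ω + B^Ω + cos(π/8) D^Ω` (KP23 Lemma 2.1, Remark 3), so `D^Ω ≤ D_M → 0` uniformly in `T`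
  (`HV.tendsto_triDl`) and wide bridges of height `T` have mass `≤ cos(π/8) D^Ω` — but `wideMass`
  sums renewal-free walks over `h ∈ [t,2t]` (`Σ_h B_h ≍ t^{3/4}` predicted: the renewal condition
  cannot be dropped), and cutting at the lateral crossing leaves a continuation from an interior
  mid-edge (no sum rule; union bounds lose `t^{13/48}`). (2) Stacking a bridge of height `s ≤ t` on a
  renewal-free walk is injective and weight-exact, whence `wideMass_t(M) Σ_{s≤t} B_s ≤ 2t cos(π/8)
  D^{Ω(3t,≍M)}`: the stub FOLLOWS from the relative lateral decay
  (★) `∀ ε ∃ A ∀ᶠ t, t · D^{Ω(3t, A t)} ≤ ε Σ_{s ≤ t} B_s` (both sides `≍ t^{3/4}` up to `e^{-cA}`);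
  walks with two renewal lines among `A` oblique lines at spacing `t` give `O(A² B_t²) = o(B_t)`
  (KP23 Lemma 3.1), the residual open case being walks of height `≤ 3t` crossing `≥ A/2` consecutive
  such lines three times each; the printed `D_M ≤ 100 M^{-10^{-10}}` (KP23 Thm 2), `B_s + c_ε E_s ≥ c/s`
  (DCS12) are far too weak. (3) Block crossings at a `t`-uniform cost `q < 1` fail at the same point:
  SAW cutting is not sub-multiplicative at `x_c` (Hammersley–Welsh gives `∏(1+B_s)` growth only), and
  with oblique walls (zigzag strips by `HV.rot60`) a cost `< 1` is paid only at renewal lines. -/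

noncomputable section

namespace Summit.CriticalPhenomena.SAWScalingLimit.Theorems.MassRatio.Renewal

open Literature.Probability.LatticeModels Literature.Probability.RandomPlanarGeometry
open Literature.Probability.RandomPlanarGeometry.SAW
open Summit.CriticalPhenomena.SAWScalingLimit.Theorems.MassRatio.Negative

namespace LateralConfinement
/-! ### Helper lemmas for `stub_lateralConfinement` (all helpers live in this sub-namespace) -/

/-- Membership in the window box (`Negative.mem_Rect`). [folklore] -/
theorem mem_box {m p : ℤ} {h W : ℕ} {v : HexVertex} :
    v ∈ box m p h W ↔ m ≤ row v ∧ row v ≤ m + h - 1 ∧ p - W ≤ pos v ∧ pos v ≤ p + W := mem_Rect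

/-- Boxes widen with the window `W`. [folklore] -/
theorem box_mono_W {m p : ℤ} {h W W' : ℕ} (hW : W ≤ W') : box m p h W ⊆ box m p h W' := by
  intro v hv; rw [mem_box] at hv ⊢; omega

/-- The kernel summands are nonnegative. [folklore] -/
theorem ite_pow_nonneg (P : Prop) [Decidable P] (n : ℕ) :
    0 ≤ (if P then hexCriticalFugacity ^ n else 0 : ℝ) := by
  split_ifs
  exacts [pow_nonneg hexCriticalFugacity_pos_lt_one.1.le _, le_rfl]

/-- Reindexing: along a map injective on the source a nonnegative sum dominates smaller terms. [folklore] -/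
theorem sum_le_sum_of_injOn {α γ : Type*} [DecidableEq γ] (s : Finset α) (u : Finset γ)
    (e : α → γ) (he : ∀ a ∈ s, ∀ a' ∈ s, e a = e a' → a = a') (hsu : ∀ a ∈ s, e a ∈ u)
    (f : α → ℝ) (g : γ → ℝ) (hfg : ∀ a ∈ s, f a ≤ g (e a)) (hg : ∀ b ∈ u, 0 ≤ g b) :
    ∑ a ∈ s, f a ≤ ∑ b ∈ u, g b := by
  calc ∑ a ∈ s, f a ≤ ∑ a ∈ s, g (e a) := Finset.sum_le_sum hfg
    _ = ∑ b ∈ s.image e, g b := (Finset.sum_image he).symm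
    _ ≤ ∑ b ∈ u, g b := by
        refine Finset.sum_le_sum_of_subset_of_nonneg (fun b hb => ?_) fun b hb _ => hg b hb
        obtain ⟨a, ha, rfl⟩ := Finset.mem_image.1 hb
        exact hsu a ha

/-- Transport to a super-domain keeps the vertex list. [folklore] -/
@[simp] theorem ofSubdomain_verts {Λ Λ' : Finset HexVertex} (hsub : Λ' ⊆ Λ) {a z : Sym2 HexVertex}
    (γ : HexMidEdgeSAW Λ' a z) : (ofSubdomain hsub γ).verts = γ.verts := rfl

/-- Transport to a super-domain is injective (a walk is its vertex list). [folklore] -/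
theorem ofSubdomain_injective {Λ Λ' : Finset HexVertex} (hsub : Λ' ⊆ Λ) {a z : Sym2 HexVertex} :
    Function.Injective (ofSubdomain hsub : HexMidEdgeSAW Λ' a z → HexMidEdgeSAW Λ a z) := by
  intro β β' h
  have h' := congrArg HexMidEdgeSAW.verts h
  exact HexMidEdgeSAW.ext h'

/-- **The renewal kernel increases with the window**: `W ≤ W' → κ_t^{W}(h,j) ≤ κ_t^{W'}(h,j)` (a box
walk of the narrow box is one of the wide box, same vertex list, length, renewal levels). [folklore] -/
theorem kernel_mono_W (m p : ℤ) (t h : ℕ) (j : ℤ) {W W' : ℕ} (hW : W ≤ W') :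
    kernel m p t W h j ≤ kernel m p t W' h j := by
  classical
  unfold kernel
  exact sum_le_sum_of_injOn Finset.univ Finset.univ (ofSubdomain (box_mono_W hW))
    (fun a _ a' _ h => ofSubdomain_injective _ h) (fun a _ => Finset.mem_univ _) _ _
    (fun β _ => le_of_eq rfl) (fun β _ => ite_pow_nonneg _ _)

/-- **The block mass increases with the window**: `W ≤ W' → boxMass m p t W ≤ boxMass m p t W'`.
[folklore] -/
theorem boxMass_mono_W (m p : ℤ) (t : ℕ) {W W' : ℕ} (hW : W ≤ W') :
    boxMass m p t W ≤ boxMass m p t W' := by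
  unfold boxMass
  refine Finset.sum_le_sum fun h _ => ?_
  calc ∑ j ∈ Finset.Icc (-(W : ℤ)) W, kernel m p t W h j
      ≤ ∑ j ∈ Finset.Icc (-(W : ℤ)) W, kernel m p t W' h j :=
        Finset.sum_le_sum fun j _ => kernel_mono_W m p t h j hW
    _ ≤ ∑ j ∈ Finset.Icc (-(W' : ℤ)) W', kernel m p t W' h j :=
        Finset.sum_le_sum_of_subset_of_nonneg (Finset.Icc_subset_Icc (by omega) (by omega))
          fun j _ _ => kernel_nonneg m p t W' h j

/-- **The monotone half of the stub**: `W ≤ A t → boxMass m p t W ≤ boxMass m p t (A t)`. [folklore] -/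
theorem boxMass_le_boxMass_mul {m p : ℤ} {t W A : ℕ} (hW : W ≤ A * t) :
    boxMass m p t W ≤ boxMass m p t (A * t) :=
  boxMass_mono_W m p t hW

/-! #### Anatomy of box walks from a top mid-edge -/

/-- A box walk from `top m p h j` forces `h ≥ 1` and `|j| ≤ W` (the top mid-edge has an endpoint
in the box, which can only be the inner one). [folklore] -/
theorem one_le_and_abs_le {m p : ℤ} {h W : ℕ} {j : ℤ}
    (β : HexMidEdgeSAW (box m p h W) (top m p h j) (door m p)) : 1 ≤ h ∧ (-(W : ℤ) ≤ j ∧ j ≤ W) := by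
  obtain ⟨-, v, hv, hvbox⟩ := β.fst_mem
  rw [top, Sym2.mem_iff] at hv
  rw [mem_box] at hvbox
  rcases hv with rfl | rfl
  · rw [row_bv] at hvbox; omega
  · rw [row_bv, pos_bv] at hvbox; omega

/-- A box walk from a top mid-edge down to the door is never the trivial walk. [folklore] -/
theorem verts_ne_nil {m p : ℤ} {h W : ℕ} {j : ℤ}
    (β : HexMidEdgeSAW (box m p h W) (top m p h j) (door m p)) : β.verts ≠ [] := by
  intro hnil
  have h1 := (one_le_and_abs_le β).1
  have hmem : bv (m + h) (p + j) ∈ door m p := by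
    rw [← β.eq_of_nil hnil, top]; exact Sym2.mem_mk_left _ _
  rw [door, Sym2.mem_iff] at hmem
  rcases hmem with h2 | h2
  · have := (bv_inj h2).1; omega
  · have := (bv_inj h2).1; omega

/-- The first vertex of a box walk from `top m p h j` is the inner endpoint `(m+h-1, p+j)` of the
top mid-edge; in particular it is visited. [folklore] -/
theorem bv_mem_verts {m p : ℤ} {h W : ℕ} {j : ℤ}
    (β : HexMidEdgeSAW (box m p h W) (top m p h j) (door m p)) : bv (m + h - 1) (p + j) ∈ β.verts := by
  obtain ⟨v, l, hvl⟩ := List.exists_cons_of_ne_nil (verts_ne_nil β)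
  have hv : v ∈ top m p h j := β.head_mem v (by rw [hvl]; rfl)
  have hvbox : v ∈ box m p h W := β.subset v (by rw [hvl]; simp)
  rw [top, Sym2.mem_iff] at hv
  rcases hv with rfl | rfl
  · rw [mem_box, row_bv] at hvbox; omega
  · rw [hvl]; simp

/-! #### The wide part of the block mass -/

/-- `Wide p V l`: the vertex list visits a vertex at lateral distance `> V` from the door position
`p` (it leaves the window `|pos - p| ≤ V`). [folklore] -/
def Wide (p : ℤ) (V : ℕ) (l : List HexVertex) : Prop := ∃ v ∈ l, (V : ℤ) < |pos v - p|

open scoped Classical in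
/-- The WIDE part of the renewal kernel: the `x_c`-mass of the box walks of `box m p h W` from
`top m p h j` to the door with no renewal level in `[t, h)` that leave the window `|pos - p| ≤ V`.
[folklore] -/
def wideKernel (m p : ℤ) (t W V h : ℕ) (j : ℤ) : ℝ :=
  ∑ β : HexMidEdgeSAW (box m p h W) (top m p h j) (door m p),
    if NoSplit m t h β.verts ∧ Wide p V β.verts then hexCriticalFugacity ^ β.length else 0

open scoped Classical in
/-- The NARROW part of the renewal kernel (walks staying in the window `|pos - p| ≤ V`). [folklore] -/
def narrowKernel (m p : ℤ) (t W V h : ℕ) (j : ℤ) : ℝ :=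
  ∑ β : HexMidEdgeSAW (box m p h W) (top m p h j) (door m p),
    if NoSplit m t h β.verts ∧ ¬ Wide p V β.verts then hexCriticalFugacity ^ β.length else 0

/-- **The wide block mass** `wideMass m p t W V = Σ_{h ∈ [t,2t]} Σ_{|j| ≤ W} wideKernel`: the part
of `boxMass m p t W` carried by renewal-free prefixes leaving the lateral window `V`. [folklore] -/
def wideMass (m p : ℤ) (t W V : ℕ) : ℝ :=
  ∑ h ∈ Finset.Icc t (2 * t), ∑ j ∈ Finset.Icc (-(W : ℤ)) W, wideKernel m p t W V h j

/-- The narrow kernel is nonnegative. [folklore] -/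
theorem narrowKernel_nonneg (m p : ℤ) (t W V h : ℕ) (j : ℤ) : 0 ≤ narrowKernel m p t W V h j := by
  classical exact Finset.sum_nonneg fun _ _ => ite_pow_nonneg _ _

/-- `κ = narrow + wide`. [folklore] -/
theorem kernel_eq_narrow_add_wide (m p : ℤ) (t W V h : ℕ) (j : ℤ) :
    kernel m p t W h j = narrowKernel m p t W V h j + wideKernel m p t W V h j := by
  classical
  unfold kernel narrowKernel wideKernel
  rw [← Finset.sum_add_distrib]
  refine Finset.sum_congr rfl fun β _ => ?_
  by_cases h1 : NoSplit m t h β.verts <;> by_cases h2 : Wide p V β.verts <;> simp [h1, h2]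

/-- **Restriction**: a box walk of `box m p h W` that stays in the window `|pos - p| ≤ V` is a box
walk of `box m p h V`, with the same vertex list. [folklore] -/
def restrict {m p : ℤ} {h W : ℕ} {j : ℤ} (V : ℕ)
    (β : HexMidEdgeSAW (box m p h W) (top m p h j) (door m p)) (hβ : ¬ Wide p V β.verts) :
    HexMidEdgeSAW (box m p h V) (top m p h j) (door m p) where
  verts := β.verts
  subset := fun v hv => by
    have hvW := β.subset v hv
    rw [mem_box] at hvW ⊢
    have hle : |pos v - p| ≤ V := not_lt.1 fun hlt => hβ ⟨v, hv, hlt⟩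
    rw [abs_le] at hle
    omega
  nodup := β.nodup
  isChain := β.isChain
  head_mem := β.head_mem
  getLast_mem := β.getLast_mem
  eq_of_nil := β.eq_of_nil
  edges_nodup := β.edges_nodup
  fst_mem := by
    have h1 := (one_le_and_abs_le β).1
    have hle : |pos (bv (m + h - 1) (p + j)) - p| ≤ V :=
      not_lt.1 fun hlt => hβ ⟨_, bv_mem_verts β, hlt⟩
    rw [pos_bv, abs_le] at hle
    refine ⟨β.fst_mem.1, bv (m + h - 1) (p + j), ?_, ?_⟩
    · rw [top]; exact Sym2.mem_mk_right _ _
    · rw [mem_box, row_bv, pos_bv]; omega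

/-- The restriction keeps the vertex list. [folklore] -/
@[simp] theorem restrict_verts {m p : ℤ} {h W : ℕ} {j : ℤ} (V : ℕ)
    (β : HexMidEdgeSAW (box m p h W) (top m p h j) (door m p)) (hβ : ¬ Wide p V β.verts) :
    (restrict V β hβ).verts = β.verts := rfl

/-- The narrow part of the kernel of the window `W` is at most the kernel of the window `V`
(restriction is injective and keeps the weight). [folklore] -/
theorem narrowKernel_le_kernel (m p : ℤ) (t W V h : ℕ) (j : ℤ) :
    narrowKernel m p t W V h j ≤ kernel m p t V h j := by
  classical
  set s := (Finset.univ : Finset (HexMidEdgeSAW (box m p h W) (top m p h j) (door m p))).filter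
      (fun β => ¬ Wide p V β.verts) with hs
  have hmem : ∀ β : ↥s, ¬ Wide p V β.1.verts := fun β => (Finset.mem_filter.1 β.2).2
  have step1 : narrowKernel m p t W V h j =
      ∑ β ∈ s, (if NoSplit m t h β.verts ∧ ¬ Wide p V β.verts then
        hexCriticalFugacity ^ β.length else 0) := by
    unfold narrowKernel
    refine (Finset.sum_subset (Finset.filter_subset _ _) ?_).symm
    intro β _ hβs
    have hw : ¬ ¬ Wide p V β.verts := fun h' => hβs (Finset.mem_filter.2 ⟨Finset.mem_univ _, h'⟩)
    exact if_neg fun h'' => hw h''.2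
  rw [step1, ← Finset.sum_attach]
  unfold kernel
  refine sum_le_sum_of_injOn s.attach Finset.univ (fun β => restrict V β.1 (hmem β)) ?_
    (fun _ _ => Finset.mem_univ _) _ _ ?_ (fun γ _ => ite_pow_nonneg _ _)
  · intro β _ β' _ hββ'
    have hv : β.1.verts = β'.1.verts := by simpa using congrArg HexMidEdgeSAW.verts hββ'
    exact Subtype.ext (HexMidEdgeSAW.ext hv)
  · intro β _
    by_cases hN : NoSplit m t h β.1.verts
    · simp [hN, hmem β, HexMidEdgeSAW.length]
    · simp [hN]

/-- The narrow kernel vanishes at top offsets outside the window `V` (the first vertex of a box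
walk from `top m p h j` sits at lateral offset `j`). [folklore] -/
theorem narrowKernel_eq_zero_of_lt (m p : ℤ) (t W V h : ℕ) {j : ℤ} (hj : (V : ℤ) < |j|) :
    narrowKernel m p t W V h j = 0 := by
  classical
  unfold narrowKernel
  refine Finset.sum_eq_zero fun β _ => if_neg fun hc => hc.2 ⟨_, bv_mem_verts β, ?_⟩
  rw [pos_bv]
  simpa using hj

/-- Summed over the top offsets of the window `W`, the narrow part is at most the row sum of the
kernel of the window `V`. [folklore] -/
theorem sum_narrowKernel_le (m p : ℤ) (t W V h : ℕ) :
    ∑ j ∈ Finset.Icc (-(W : ℤ)) W, narrowKernel m p t W V h j ≤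
      ∑ j ∈ Finset.Icc (-(V : ℤ)) V, kernel m p t V h j := by
  classical
  calc ∑ j ∈ Finset.Icc (-(W : ℤ)) W, narrowKernel m p t W V h j
      ≤ ∑ j ∈ Finset.Icc (-(W : ℤ)) W, (if |j| ≤ (V : ℤ) then kernel m p t V h j else 0) := by
        refine Finset.sum_le_sum fun j _ => ?_
        split_ifs with hjV
        · exact narrowKernel_le_kernel m p t W V h j
        · exact (narrowKernel_eq_zero_of_lt m p t W V h (not_le.1 hjV)).le
    _ = ∑ j ∈ (Finset.Icc (-(W : ℤ)) W).filter (fun j => |j| ≤ (V : ℤ)), kernel m p t V h j :=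
        (Finset.sum_filter _ _).symm
    _ ≤ ∑ j ∈ Finset.Icc (-(V : ℤ)) V, kernel m p t V h j := by
        refine Finset.sum_le_sum_of_subset_of_nonneg (fun j hj => ?_) fun j _ _ => kernel_nonneg ..
        rw [Finset.mem_filter, Finset.mem_Icc, abs_le] at hj
        rw [Finset.mem_Icc]
        exact hj.2

/-- **Decomposition of the block mass by the lateral window**: for all windows `W`, `V`,
`boxMass m p t W ≤ boxMass m p t V + wideMass m p t W V`. [folklore] -/
theorem boxMass_le_add_wideMass (m p : ℤ) (t W V : ℕ) :
    boxMass m p t W ≤ boxMass m p t V + wideMass m p t W V := by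
  unfold boxMass wideMass
  rw [← Finset.sum_add_distrib]
  refine Finset.sum_le_sum fun h _ => ?_
  calc ∑ j ∈ Finset.Icc (-(W : ℤ)) W, kernel m p t W h j
      = ∑ j ∈ Finset.Icc (-(W : ℤ)) W, narrowKernel m p t W V h j +
          ∑ j ∈ Finset.Icc (-(W : ℤ)) W, wideKernel m p t W V h j := by
        rw [← Finset.sum_add_distrib]
        exact Finset.sum_congr rfl fun j _ => kernel_eq_narrow_add_wide m p t W V h j
    _ ≤ ∑ j ∈ Finset.Icc (-(V : ℤ)) V, kernel m p t V h j +
          ∑ j ∈ Finset.Icc (-(W : ℤ)) W, wideKernel m p t W V h j :=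
        add_le_add (sum_narrowKernel_le m p t W V h) le_rfl

/-! #### The converse bookkeeping: the wide mass is exactly the excess -/

/-- For `V ≤ W` every box walk of the window `V` is a NARROW box walk of the window `W`:
`Σ_{|j| ≤ V} κ^{V} ≤ Σ_{|j| ≤ W} narrowKernel^{W,V}`. [folklore] -/
theorem sum_kernel_le_sum_narrowKernel (m p : ℤ) (t W V h : ℕ) (hVW : V ≤ W) :
    ∑ j ∈ Finset.Icc (-(V : ℤ)) V, kernel m p t V h j ≤
      ∑ j ∈ Finset.Icc (-(W : ℤ)) W, narrowKernel m p t W V h j := by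
  classical
  refine le_trans (Finset.sum_le_sum fun j _ => ?_)
    (Finset.sum_le_sum_of_subset_of_nonneg (Finset.Icc_subset_Icc (by omega) (by omega))
      fun j _ _ => narrowKernel_nonneg m p t W V h j)
  unfold kernel narrowKernel
  refine sum_le_sum_of_injOn Finset.univ Finset.univ (ofSubdomain (box_mono_W hVW))
    (fun a _ a' _ h => ofSubdomain_injective _ h) (fun a _ => Finset.mem_univ _) _ _
    (fun β _ => ?_) (fun β _ => ite_pow_nonneg _ _)
  have hnw : ¬ Wide p V β.verts := by
    rintro ⟨v, hv, hlt⟩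
    have hvbox := β.subset v hv
    rw [mem_box] at hvbox
    rw [lt_abs] at hlt
    omega
  by_cases hN : NoSplit m t h β.verts
  · simp [hN, hnw, HexMidEdgeSAW.length]
  · simp [hN]

/-- For `V ≤ W` the wide mass is at most the excess `boxMass m p t W - boxMass m p t V` (so, with
`boxMass_le_add_wideMass`, it IS the excess). [folklore] -/
theorem wideMass_le_sub (m p : ℤ) (t W V : ℕ) (hVW : V ≤ W) :
    wideMass m p t W V ≤ boxMass m p t W - boxMass m p t V := by
  rw [le_sub_iff_add_le]
  unfold boxMass wideMass
  rw [← Finset.sum_add_distrib]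
  refine Finset.sum_le_sum fun h _ => ?_
  calc ∑ j ∈ Finset.Icc (-(W : ℤ)) W, wideKernel m p t W V h j +
        ∑ j ∈ Finset.Icc (-(V : ℤ)) V, kernel m p t V h j
      ≤ ∑ j ∈ Finset.Icc (-(W : ℤ)) W, wideKernel m p t W V h j +
        ∑ j ∈ Finset.Icc (-(W : ℤ)) W, narrowKernel m p t W V h j :=
        add_le_add le_rfl (sum_kernel_le_sum_narrowKernel m p t W V h hVW)
    _ = ∑ j ∈ Finset.Icc (-(W : ℤ)) W, kernel m p t W h j := by
        rw [← Finset.sum_add_distrib]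
        exact Finset.sum_congr rfl fun j _ => by rw [kernel_eq_narrow_add_wide m p t W V h j, add_comm]

/-- For `W ≤ V` no box walk of the window `W` is wide: `wideMass m p t W V = 0`. [folklore] -/
theorem wideMass_eq_zero (m p : ℤ) (t W V : ℕ) (hWV : W ≤ V) : wideMass m p t W V = 0 := by
  classical
  unfold wideMass wideKernel
  refine Finset.sum_eq_zero fun h _ => Finset.sum_eq_zero fun j _ => Finset.sum_eq_zero fun β _ => ?_
  refine if_neg fun hc => ?_
  obtain ⟨v, hv, hlt⟩ := hc.2
  have hvbox := β.subset v hv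
  rw [mem_box] at hvbox
  rw [lt_abs] at hlt
  omega

/-! #### The missing fact, typed, and the two reductions -/

/-- **Uniform lateral tightness** of a two-window mass `w m p t W V` (used at `w = wideMass`): for
every `ε > 0` there are an aspect ratio `A ≥ 1` and a scale `t₂` with `w m p t W (A t) ≤ ε` for all
`t ≥ t₂`, every window `W` and every door. At `w = wideMass` — the `x_c`-mass of the box walks of
height `h ∈ [t,2t]`, top edge down to the door, no renewal level in `[t,h)`, LEAVING the window
`|pos - p| ≤ A t` — this is EQUIVALENT to the registered stub (the two reductions below) and OPEN;
see the module docstring for the obstructions and for the sufficient relative lateral decay (★).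
[folklore] -/
def LateralTightness (w : ℤ → ℤ → ℕ → ℕ → ℕ → ℝ) : Prop :=
  ∀ ε : ℝ, 0 < ε → ∃ A : ℕ, 1 ≤ A ∧ ∃ t₂ : ℕ, ∀ t : ℕ, t₂ ≤ t →
    ∀ (W : ℕ) (m p : ℤ), (p - m) % 2 = 0 → w m p t W (A * t) ≤ ε

/-- **Reduction**: uniform lateral tightness of the wide block mass implies the registered stub
`stub_lateralConfinement` (by `boxMass_le_add_wideMass`). [folklore] -/
theorem stub_lateralConfinement_of_lateralTightness (H : LateralTightness wideMass) :
    ∀ ε : ℝ, 0 < ε → ∃ A : ℕ, 1 ≤ A ∧ ∃ t₂ : ℕ, ∀ t : ℕ, t₂ ≤ t →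
      ∀ (W : ℕ) (m p : ℤ), (p - m) % 2 = 0 → boxMass m p t W ≤ boxMass m p t (A * t) + ε := by
  intro ε hε
  obtain ⟨A, hA, t₂, ht⟩ := H ε hε
  exact ⟨A, hA, t₂, fun t htt W m p hpm =>
    (boxMass_le_add_wideMass m p t W (A * t)).trans (add_le_add le_rfl (ht t htt W m p hpm))⟩

/-- **Converse reduction**: the registered stub implies uniform lateral tightness of the wide block
mass (`wideMass_le_sub` for `A t ≤ W`, `wideMass_eq_zero` for `W ≤ A t`): the typed fact
`LateralTightness wideMass` is exactly the content of the stub. [folklore] -/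
theorem lateralTightness_of_stub
    (H : ∀ ε : ℝ, 0 < ε → ∃ A : ℕ, 1 ≤ A ∧ ∃ t₂ : ℕ, ∀ t : ℕ, t₂ ≤ t →
      ∀ (W : ℕ) (m p : ℤ), (p - m) % 2 = 0 → boxMass m p t W ≤ boxMass m p t (A * t) + ε) :
    LateralTightness wideMass := by
  intro ε hε
  obtain ⟨A, hA, t₂, ht⟩ := H ε hε
  refine ⟨A, hA, t₂, fun t htt W m p hpm => ?_⟩
  rcases le_total (A * t) W with hle | hle
  · have h1 := wideMass_le_sub m p t W (A * t) hle
    have h2 := ht t htt W m p hpm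
    linarith
  · rw [wideMass_eq_zero m p t W (A * t) hle]
    exact hε.le

end LateralConfinement

/-- **Registered sub-goal (crux item stmt-CriticalPhenomena-8550)**: the open stub `stub_lateralConfinement`
follows from `LateralTightness wideMass` (converse: `LateralConfinement.lateralTightness_of_stub`). [folklore] -/
theorem lateralConfinement_of_lateralTightness :
    LateralConfinement.LateralTightness LateralConfinement.wideMass →
      ∀ ε : ℝ, 0 < ε → ∃ A : ℕ, 1 ≤ A ∧ ∃ t₂ : ℕ, ∀ t : ℕ, t₂ ≤ t →
        ∀ (W : ℕ) (m p : ℤ), (p - m) % 2 = 0 → boxMass m p t W ≤ boxMass m p t (A * t) + ε :=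
  LateralConfinement.stub_lateralConfinement_of_lateralTightness

end Summit.CriticalPhenomena.SAWScalingLimit.Theorems.MassRatio.Renewal
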